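import Mathlib
import Summits.Ventures.HodgeRepro2.T5CyclotomicSubfieldCyclicInert

/-!
# THE MAXIMAL REAL SUBFIELD OF A CM SUBFIELD OF `ℚ(ζₘ)` IS THE FIXED FIELD OF `⟨H_F, −1⟩`

Tier-5 support N2 / N3 / §G-N4.2 (seat p3, gen 82). For a CM subfield `F ⊆ ℚ(ζₘ)` the cell's census (files 286,
293, 300) reads the places of `F⁺` through the tower `F / F⁺ / ℚ`. This file identifies `F⁺` itself inside `ℚ(ζₘ)`:
it is the fixed field of the subgroup generated by `Gal(ℚ(ζₘ)/F)` and complex conjugation, i.e. of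
`⟨H_F, −1⟩ ≤ (ℤ/mℤ)ˣ` under `galEquivZMod` (file 292: the conjugation of `ℚ(ζₘ)` is `−1`), so that
`Gal(F⁺/ℚ) ≃* (ℤ/mℤ)ˣ / ⟨H_F, −1⟩` and the residue degree of a prime of `F⁺` above `p ∤ m` is the order of `p`
in that quotient — ONE formula for the two regimes of file 300.

* `realSubfield L F := fixedField (H_F ⊔ ⟨c⟩)` (an intermediate field of `L`); **`mem_realSubfield_iff`**:
  `x ∈ F⁺ ⟺ x ∈ F ∧ c x = x`; `realSubfield_le`; **`mem_realSubfield_iff_mem_maximalRealSubfield`** (for `x ∈ F`: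
  `x ∈ realSubfield ⟺ x ∈ maximalRealSubfield F` — file 292's restriction of the conjugation and Mathlib's
  `complexConj_eq_self_iff`); **`map_maximalRealSubfield_eq`**: the image of Mathlib's `maximalRealSubfield F` in
  `L` IS `realSubfield`;
* **`fixingSubgroup_realSubfield`**, **`zmodSubgroup_realSubfield`**: `H_{F⁺} = H_F ⊔ ⟨−1⟩`;
* **`galEquivQuotient_realSubfield`**: `Gal(F⁺/ℚ) ≃* (ℤ/mℤ)ˣ / (H_F ⊔ ⟨−1⟩)`; `card_quotient_realSubfield`;
* **`inertiaDeg_realSubfield_eq_orderOf_mk`**: `f(𝔮/p) = ord(p · ⟨H_F, −1⟩)` for every prime `𝔮` of `F⁺` above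
  `p ∤ m` (file 286 on the intermediate field `realSubfield`); `absNorm_realSubfield_eq`: `N(𝔮) = p^{f}`.

§8(d): uses an L-value-free non-vanishing device: NO.
-/

open NumberField NumberField.IsCMField IsCyclotomicExtension.Rat Ideal IsDedekindDomain
  IsDedekindDomain.HeightOneSpectrum
open Summit.Ventures.HodgeRepro2.T5CMTypeGaloisDialect Summit.Ventures.HodgeRepro2.T5CyclotomicSubfieldInertiaDeg
  Summit.Ventures.HodgeRepro2.T5CyclotomicConjugation Summit.Ventures.HodgeRepro2.T5CyclotomicSubfieldCyclicInert

namespace Summit.Ventures.HodgeRepro2.T5CyclotomicSubfieldRealSubfield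

section Generic

/-- The order of a class modulo `H` is the order of the same class modulo `H'` when `H = H'`. -/
theorem orderOf_mk_congr {G : Type*} [Group G] {H H' : Subgroup G} [H.Normal] [H'.Normal] (h : H = H') (a : G) :
    orderOf (QuotientGroup.mk a : G ⧸ H) = orderOf (QuotientGroup.mk a : G ⧸ H') := by
  subst h
  rfl

end Generic

section Definition

variable (L : Type*) [Field L] [NumberField L] [IsCMField L] (F : IntermediateField ℚ L)

/-- **The real subfield of `F` inside `L`** (`L` a CM number field Galois over `ℚ`, e.g. `ℚ(ζₘ)`): the fixed field of
the subgroup generated by `Gal(L/F)` and the complex conjugation `c = conjGal L`. -/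
noncomputable def realSubfield : IntermediateField ℚ L :=
  IntermediateField.fixedField (F.fixingSubgroup ⊔ Subgroup.zpowers (conjGal L))

variable [IsGalois ℚ L]

/-- **Membership**: `x ∈ realSubfield ⟺ x ∈ F ∧ c x = x`. -/
theorem mem_realSubfield_iff (x : L) : x ∈ realSubfield L F ↔ x ∈ F ∧ conjGal L x = x := by
  rw [realSubfield, IntermediateField.mem_fixedField_iff]
  constructor
  · intro h
    refine ⟨?_, h _ (Subgroup.mem_sup_right (Subgroup.mem_zpowers _))⟩
    rw [← IsGalois.fixedField_fixingSubgroup F, IntermediateField.mem_fixedField_iff]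
    exact fun σ hσ => h σ (Subgroup.mem_sup_left hσ)
  · rintro ⟨hF, hc⟩ σ hσ
    have hle : F.fixingSubgroup ⊔ Subgroup.zpowers (conjGal L) ≤ MulAction.stabilizer (L ≃ₐ[ℚ] L) x := by
      refine sup_le ?_ ?_
      · intro τ hτ
        exact (IntermediateField.mem_fixingSubgroup_iff F τ).mp hτ x hF
      · rw [Subgroup.zpowers_le]
        exact hc
    exact hle hσ

/-- `realSubfield ≤ F`. -/
theorem realSubfield_le : realSubfield L F ≤ F := fun x hx => ((mem_realSubfield_iff L F x).mp hx).1

variable [IsCMField F] [Normal ℚ F]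

/-- **`realSubfield` IS the maximal real subfield**: for `x ∈ F`, `x ∈ realSubfield ⟺ x ∈ maximalRealSubfield F`
(the conjugation of `L` restricts to that of `F`, file 292; `complexConj F x = x ⟺ x ∈ F⁺`, Mathlib). -/
theorem mem_realSubfield_iff_mem_maximalRealSubfield (x : F) :
    (x : L) ∈ realSubfield L F ↔ x ∈ maximalRealSubfield F := by
  rw [mem_realSubfield_iff, ← complexConj_eq_self_iff, ← conjGal_apply]
  refine ⟨fun h => ?_, fun h => ⟨x.2, ?_⟩⟩
  · apply (algebraMap F L).injective
    have := AlgEquiv.restrictNormal_commutes (conjGal L) F x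
    rw [restrictNormal_conjGal L F] at this
    rw [this]
    exact h.2
  · have := AlgEquiv.restrictNormal_commutes (conjGal L) F x
    rw [restrictNormal_conjGal L F, h] at this
    exact this.symm

/-- **The image of `maximalRealSubfield F` in `L` is `realSubfield`** (as subfields of `L`). -/
theorem map_maximalRealSubfield_eq :
    (maximalRealSubfield F).map (algebraMap F L) = (realSubfield L F).toSubfield := by
  ext y
  rw [Subfield.mem_map]
  constructor
  · rintro ⟨x, hx, rfl⟩
    exact (mem_realSubfield_iff_mem_maximalRealSubfield L F x).mpr hx
  · intro hy
    have hyF : y ∈ F := realSubfield_le L F hy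
    exact ⟨⟨y, hyF⟩, (mem_realSubfield_iff_mem_maximalRealSubfield L F ⟨y, hyF⟩).mp hy, rfl⟩

end Definition

section Galois

variable (m : ℕ) [NeZero m] (L : Type*) [Field L] [NumberField L] [IsCyclotomicExtension {m} ℚ L] [IsCMField L]
  (F : IntermediateField ℚ L)

omit [NeZero m] [IsCyclotomicExtension {m} ℚ L] in
/-- **The fixing subgroup of `realSubfield` is `Gal(L/F) ⊔ ⟨c⟩`** (the Galois correspondence, `L` finite over `ℚ`). -/
theorem fixingSubgroup_realSubfield :
    (realSubfield L F).fixingSubgroup = F.fixingSubgroup ⊔ Subgroup.zpowers (conjGal L) :=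
  IntermediateField.fixingSubgroup_fixedField _

/-- **`H_{F⁺} = H_F ⊔ ⟨−1⟩`** in `(ℤ/mℤ)ˣ` (file 292: `galEquivZMod c = −1`). -/
theorem zmodSubgroup_realSubfield :
    zmodSubgroup m L (realSubfield L F) = zmodSubgroup m L F ⊔ Subgroup.zpowers (-1) := by
  unfold zmodSubgroup
  rw [fixingSubgroup_realSubfield, OrderIso.map_sup, MulEquiv.mapSubgroup_apply, MulEquiv.mapSubgroup_apply]
  congr 1
  rw [MonoidHom.map_zpowers]
  congr 1
  exact galEquivZMod_conjGal m L

/-- **`Gal(F⁺/ℚ) ≃* (ℤ/mℤ)ˣ / (H_F ⊔ ⟨−1⟩)`** (file 301's `galEquivQuotient` on `realSubfield`). -/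
noncomputable def galEquivQuotient_realSubfield :
    (realSubfield L F ≃ₐ[ℚ] realSubfield L F) ≃* (ZMod m)ˣ ⧸ (zmodSubgroup m L F ⊔ Subgroup.zpowers (-1)) :=
  haveI : IsGalois ℚ (realSubfield L F) := T5CyclotomicUnramified.isGalois_intermediateField L m _
  (galEquivQuotient m L (realSubfield L F)).trans
    (QuotientGroup.quotientMulEquivOfEq (zmodSubgroup_realSubfield m L F))

/-- `#((ℤ/mℤ)ˣ / (H_F ⊔ ⟨−1⟩)) = [F⁺ : ℚ]`. -/
theorem card_quotient_realSubfield :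
    Nat.card ((ZMod m)ˣ ⧸ (zmodSubgroup m L F ⊔ Subgroup.zpowers (-1))) =
      Module.finrank ℚ (realSubfield L F) := by
  rw [← card_quotient m L (realSubfield L F)]
  exact Nat.card_congr (QuotientGroup.quotientMulEquivOfEq (zmodSubgroup_realSubfield m L F)).toEquiv.symm

end Galois

section Primes

variable (m : ℕ) [NeZero m] (L : Type*) [Field L] [NumberField L] [IsCyclotomicExtension {m} ℚ L] [IsCMField L]
  (F : IntermediateField ℚ L)
variable (p : ℕ) [hp : Fact p.Prime] (hpm : p.Coprime m)
  (𝔮 : Ideal (𝓞 (realSubfield L F))) [h𝔮 : 𝔮.IsPrime] [h𝔮p : 𝔮.LiesOver (span {(p : ℤ)})]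

include hpm h𝔮 h𝔮p in
/-- **THE RESIDUE DEGREE OF A PRIME OF `F⁺` ABOVE `p ∤ m` IS THE ORDER OF `p` IN `(ℤ/mℤ)ˣ / ⟨H_F, −1⟩`** — one
formula for the two regimes of file 300 (`ord(p · H_F)/2` at a non-split place, `ord(p · H_F)` at a split one). -/
theorem inertiaDeg_realSubfield_eq_orderOf_mk :
    𝔮.inertiaDeg ℤ =
      orderOf (QuotientGroup.mk (ZMod.unitOfCoprime p hpm) :
        (ZMod m)ˣ ⧸ (zmodSubgroup m L F ⊔ Subgroup.zpowers (-1))) := by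
  rw [inertiaDeg_eq_orderOf_mk m L (realSubfield L F) p hpm 𝔮]
  exact orderOf_mk_congr (zmodSubgroup_realSubfield m L F) _

include hpm h𝔮 h𝔮p in
/-- `N(𝔮) = p^{ord(p · ⟨H_F, −1⟩)}`. -/
theorem absNorm_realSubfield_eq :
    Ideal.absNorm 𝔮 =
      p ^ orderOf (QuotientGroup.mk (ZMod.unitOfCoprime p hpm) :
        (ZMod m)ˣ ⧸ (zmodSubgroup m L F ⊔ Subgroup.zpowers (-1))) := by
  rw [← inertiaDeg_realSubfield_eq_orderOf_mk m L F p hpm 𝔮]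
  exact (Ideal.pow_inertiaDeg p 𝔮).symm

end Primes

end Summit.Ventures.HodgeRepro2.T5CyclotomicSubfieldRealSubfield
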